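import Mathlib
import HarnessLib
import Literature.Combinatorics.Additive.KempermanStructureTheoremGrynkiewicz
import Literature.Combinatorics.Additive.StepBeyondKempermanTypes
import Literature.Combinatorics.Additive.StepBeyondKempermanQuotientKST

/-!
# Grynkiewicz 2009, §6 Claim 5, case `l = 4`, type (I): «Thus the theorem holds with type (VIII)»

[cite: Grynkiewicz2009, §6 Claim 5 (proof of Thm 4.1, p. 26, case l = 4, type (I)); §4 (type (VIII))]
[tag: critical-pair] [tag: inverse-theorem]

Topic `Literature/Combinatorics/Additive`.  Cell `mm-stpp` (D-0046), seat `mm-stpp-lit` (gen 24); the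
port of D. J. Grynkiewicz, *A step beyond Kemperman's structure theorem*, Mathematika **55** (2009)
67–114 continued.  §6 Claim 5, case `l = 4`, END of the type (I) paragraph (print p. 26): «Since `L = K`,
and since `φ_K(a₁) + φ_K(b₁)` is a unique expression element, it follows that `φ_L(a₁) + φ_L(b₁)` is a
unique expression element in addition to the unique expression element `φ_L(A₀′) + φ_L(B₀′)`.  Hence,
since `a₁ ∉ A₀′` and since `b₁ ∉ B₀′`, then applying KST modulo `L = K`, it follows that we must have
type (II) with (by appropriate choice of sign) both `φ_L(aᵢ)` and `φ_L(bᵢ)` the first term in their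
respective arithmetic progression, and both `φ_L(A₀′)` and `φ_L(B₀′)` the last term in their respective
arithmetic progression.  Thus the theorem holds with type (VIII).»

THIS FILE is the «Thus»: the construction of the decomposition of Theorem 4.1 with bottom pair of type
(VIII) (§4, print p. 10: «(VIII) there exists a subgroup `K ≅ ℤ/2ℤ × ℤ/2ℤ` such that `(φ_K(A), φ_K(B))`
is of type (II), `A`, `B` and `A + B` are aperiodic, and `d⊆(A, A + K) = d⊆(B, B + K) = 4` with each of
the 4 end terms of `φ_K(A)` and `φ_K(B)` containing exactly 2 `K`-holes»; tree `IsTypeVIII`,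
`IsGrynkiewiczDecomp` of `StepBeyondKempermanTypes.lean`), stated at the level of `G` (the print's `G`,
not `G/H`) from the data the `l = 4` analysis delivers (`StepBeyondKempermanFourPairs.lean`,
`KempermanTypeOneFourPairs.lean`):
* the Klein group `K = H ∪ (d + H)` (`|K| = 4`, `2K = 0`, `|H| = 2`, `d ∈ K ∖ H`),
* `x, a₀ ∈ A`, `y, b₀ ∈ B` with `K`-sections `A ∩ (x + K) = {x, x + d}`, `A ∩ (a₀ + K) = a₀ + H`,
  `B ∩ (y + K) = {y, y + d}`, `B ∩ (b₀ + K) = b₀ + H`, all other `K`-cosets of `A` and `B` full,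
  `x ≢ a₀`, `y ≢ b₀ (mod K)`,
* `φ_K(x) + φ_K(y)` and `φ_K(a₀) + φ_K(b₀)` uniquely expressed in `φ_K(A) + φ_K(B)` and
  `|φ_K(A + B)| = |φ_K(A)| + |φ_K(B)| − 1` (conditions (i), (ii) for `L = K`).
«Applying KST modulo `L = K`» is the tree's KST WITH (iii) in `G ⧸ K`
(`exists_isKempermanDecomp`, `KempermanStructureTheoremGrynkiewicz.lean`): by (iii) both unique
expression elements lie in the bottom pair `(Â₀, B̂₀)`, which excludes types (I), (III), (IV) and, for
type (II), puts them at the two ends (`IsElementaryII.exists_apFinset_of_two_unique`; «by appropriate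
choice of sign» = `apFinset_eq_reverse`).  The decomposition `(M; Â₁, Â₀, B̂₁, B̂₀)` of
`(φ_K(A), φ_K(B))` is then pulled back to `G`: quasi-period `N = φ_K⁻¹(M)`, parts
`A₁ = {a : φ_K(a) ∈ Â₁}`, `A₀ = {a : φ_K(a) ∈ Â₀}` (and for `B`); the periodic parts are unions of full
`K`-cosets, conditions (i), (ii) transfer (`cosetCount_comap_mk`), and the bottom pair `(A₀, B₀)` is of
type (VIII) with the group `K`: `φ_K(A₀) = Â₀`, `φ_K(B₀) = B̂₀` are the progressions, the `K`-holes of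
`A₀` are the two in `x + K` and the two in `a₀ + K` (the end terms), and `A₀`, `B₀`, `A₀ + B₀` are
aperiodic by the SECTION ARGUMENT `not_isPeriodic_of_sections`: a set whose `K`-sections are
`{p₁, p₁ + d}`, `p₂ + H` and otherwise full `K`-cosets has no period (a period in `K` would fix both
small sections, forcing it into `⟨d⟩ ∩ H = 0`; a period outside `K` would carry `{p₁, p₁ + d}` onto a
section of size `2`, i.e. onto `p₂ + H`, forcing `d ∈ H`) — for `A₀ + B₀` the two small sections are
`{x + y, x + y + d}` and `a₀ + b₀ + H` by the two unique expressions, and the other sections are full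
because every middle term of `φ_K(A₀) + φ_K(B₀)` is a sum with a middle (full) term or the sum of two
opposite end terms (`{x, x + d} + (b₀ + H) = x + b₀ + K`).  (The print leaves these verifications to the
reader: «Thus the theorem holds with type (VIII)».)

MAIN RESULTS (0 definitions, 0 named facts; everything PROVED).
* `Grynkiewicz2009.apFinset_eq_reverse`, `Grynkiewicz2009.image_apFinset`,
  `IsElementaryII.exists_apFinset_of_two_unique`.
* `Grynkiewicz2009.not_isPeriodic_of_sections` (the section argument),
  `Grynkiewicz2009.card_add_carrier_of_sections` (`|S + K| = |S| + 4`).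
* **`Grynkiewicz2009.exists_isGrynkiewiczDecomp_typeVIII`** — the decomposition of Theorem 4.1 with a
  type (VIII) bottom pair, from the data above.

## References
* D. J. Grynkiewicz, *A step beyond Kemperman's structure theorem*, Mathematika 55 (2009) 67–114,
  doi:10.1112/S0025579300000966, §6 Claim 5 (p. 26, type (I) ⟹ type (VIII)); §4 p. 10 (type (VIII));
  §2 p. 4 (KST (iii)) [cite: Grynkiewicz2009, Thm 4.1 (proof, Claim 5)] — held
  `paper:doi-10-1112-s0025579300000966`, p0010, p0026 read 2026-08-29.
-/

namespace Literature.Combinatorics.Additive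

open Finset
open scoped Pointwise

universe u

variable {G : Type u} [AddCommGroup G] [DecidableEq G]

namespace Grynkiewicz2009

/-! ### Progressions: reversal, images, the ends of a type (II) pair -/

/-- «by appropriate choice of sign»: a progression read backwards,
`{a, a + e, …, a + ne} = {a + ne, a + ne − e, …, a}`. [cite: Grynkiewicz2009, §6 Claim 5 (p. 26)] -/
theorem apFinset_eq_reverse (a e : G) (n : ℕ) :
    apFinset a e (n + 1) = apFinset (a + n • e) (-e) (n + 1) := by
  ext z
  simp only [mem_apFinset]
  constructor
  · rintro ⟨i, hi, rfl⟩
    refine ⟨n - i, by omega, ?_⟩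
    have hn : n • e = (n - i) • e + i • e := by rw [← add_nsmul]; congr 1; omega
    rw [hn, smul_neg]
    abel
  · rintro ⟨j, hj, rfl⟩
    refine ⟨n - j, by omega, ?_⟩
    have hn : n • e = (n - j) • e + j • e := by rw [← add_nsmul]; congr 1; omega
    rw [hn, smul_neg]
    abel

omit [DecidableEq G] in
/-- The image of a progression under a homomorphism is the progression of the images.
[cite: Grynkiewicz2009, §2 (φ_H notation)] -/
theorem image_apFinset {G' : Type*} [AddCommGroup G'] [DecidableEq G] [DecidableEq G']
    (f : G →+ G') (a e : G) (n : ℕ) :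
    (apFinset a e n).image f = apFinset (f a) (f e) n := by
  ext z
  simp only [mem_image, mem_apFinset]
  constructor
  · rintro ⟨w, ⟨i, hi, rfl⟩, rfl⟩
    exact ⟨i, hi, by rw [map_add, map_nsmul]⟩
  · rintro ⟨i, hi, rfl⟩
    exact ⟨a + i • e, ⟨i, hi, rfl⟩, by rw [map_add, map_nsmul]⟩

/-- Distinct indices give distinct terms in a progression listed without repetition.
[cite: Grynkiewicz2009, §2] -/
theorem nsmul_injOn_of_card_apFinset {a e : G} {n : ℕ} (h : #(apFinset a e n) = n) {i j : ℕ}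
    (hi : i < n) (hj : j < n) (he : a + i • e = a + j • e) : i = j := by
  have hinj : Set.InjOn (fun i : ℕ => a + i • e) (range n) := by
    refine (card_image_iff).1 ?_
    rw [card_range]; exact h
  exact hinj (mem_coe.2 (mem_range.2 hi)) (mem_coe.2 (mem_range.2 hj)) he

end Grynkiewicz2009

/-- **The ends of a type (II) pair.**  In a type (II) pair `(X, Y)` an element `u + v` (`u ∈ X`,
`v ∈ Y`) that is uniquely expressed is the sum of the two first terms or of the two last terms; hence if
`u + v` and `u' + v'` are both uniquely expressed with `u ≠ u'`, then, «by appropriate choice of sign»,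
`X = {u, u + e, …}` and `Y = {v, v + e, …}` with `u'`, `v'` the last terms and the order of `e` at least
`|X| + |Y| − 1`. [cite: Grynkiewicz2009, §6 Claim 5 (p. 26, «we must have type (II) with … first term …
last term»)] -/
theorem IsElementaryII.exists_apFinset_of_two_unique {X Y : Finset G} (hII : IsElementaryII X Y)
    {u v u' v' : G} (hu : u ∈ X) (hv : v ∈ Y) (hu' : u' ∈ X) (hv' : v' ∈ Y) (hne : u ≠ u')
    (h1 : X.addConvolution Y (u + v) = 1) (h2 : X.addConvolution Y (u' + v') = 1) :
    ∃ e : G, X = apFinset u e #X ∧ Y = apFinset v e #Y ∧ u' = u + (#X - 1) • e ∧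
      v' = v + (#Y - 1) • e ∧ (addOrderOf e = 0 ∨ #X + #Y - 1 ≤ addOrderOf e) := by
  obtain ⟨hX2, hY2, e, ⟨a, hX⟩, ⟨b, hY⟩, hord⟩ := hII
  have he : e ≠ 0 := IsElementaryII.ne_zero hX2 ⟨a, hX⟩
  -- the end conditions
  have ends : ∀ {u v : G}, u ∈ X → v ∈ Y → X.addConvolution Y (u + v) = 1 →
      (u = a ∧ v = b) ∨ (u = a + (#X - 1) • e ∧ v = b + (#Y - 1) • e) := by
    intro u v hu hv h1
    have huniq := (addConvolution_add_eq_one_iff hu hv).1 h1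
    have hu2 := hu; rw [hX] at hu2
    have hv2 := hv; rw [hY] at hv2
    obtain ⟨i, hi, hiu⟩ := mem_apFinset.1 hu2
    obtain ⟨j, hj, hjv⟩ := mem_apFinset.1 hv2
    have c1 : i = 0 ∨ j + 1 = #Y := by
      by_contra hno
      push Not at hno
      have hi1 : a + (i - 1) • e ∈ X := by rw [hX]; exact mem_apFinset.2 ⟨i - 1, by omega, rfl⟩
      have hj1 : b + (j + 1) • e ∈ Y := by rw [hY]; exact mem_apFinset.2 ⟨j + 1, by omega, rfl⟩
      have hid : i • e = (i - 1) • e + e := by rw [← succ_nsmul]; congr 1; omega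
      have eq := huniq _ hi1 _ hj1 (by rw [← hiu, ← hjv, hid, succ_nsmul]; abel)
      rw [← hjv, succ_nsmul] at eq
      exact he (add_eq_left.1 (add_left_cancel eq))
    have c2 : i + 1 = #X ∨ j = 0 := by
      by_contra hno
      push Not at hno
      have hi1 : a + (i + 1) • e ∈ X := by rw [hX]; exact mem_apFinset.2 ⟨i + 1, by omega, rfl⟩
      have hj1 : b + (j - 1) • e ∈ Y := by rw [hY]; exact mem_apFinset.2 ⟨j - 1, by omega, rfl⟩
      have hjd : j • e = (j - 1) • e + e := by rw [← succ_nsmul]; congr 1; omega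
      have eq := huniq _ hi1 _ hj1 (by rw [← hiu, ← hjv, hjd, succ_nsmul]; abel)
      rw [← hjv, hjd] at eq
      exact he (add_eq_left.1 (add_left_cancel eq).symm)
    rcases Nat.eq_zero_or_pos i with hi0 | hipos
    · have hj0 : j = 0 := by rcases c2 with h | h <;> omega
      left
      rw [← hiu, ← hjv, hi0, hj0, zero_nsmul, add_zero, add_zero]
      exact ⟨rfl, rfl⟩
    · have hjY : j + 1 = #Y := by rcases c1 with h | h <;> omega
      have hiX : i + 1 = #X := by rcases c2 with h | h <;> omega
      right
      rw [← hiu, ← hjv, show #X - 1 = i by omega, show #Y - 1 = j by omega]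
      exact ⟨rfl, rfl⟩
  rcases ends hu hv h1 with ⟨hua, hvb⟩ | ⟨hua, hvb⟩ <;>
    rcases ends hu' hv' h2 with ⟨hua', hvb'⟩ | ⟨hua', hvb'⟩
  · exact absurd (hua.trans hua'.symm) hne
  · -- `u, v` first; `u', v'` last
    refine ⟨e, ?_, ?_, ?_, ?_, hord⟩
    · rw [hua]; exact hX
    · rw [hvb]; exact hY
    · rw [hua', hua]
    · rw [hvb', hvb]
  · -- `u, v` last; `u', v'` first: reverse the sign
    obtain ⟨m, hm⟩ : ∃ m, #X = m + 1 := ⟨#X - 1, by omega⟩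
    obtain ⟨n, hn⟩ : ∃ n, #Y = n + 1 := ⟨#Y - 1, by omega⟩
    refine ⟨-e, ?_, ?_, ?_, ?_, ?_⟩
    · rw [hua, hm, Nat.add_sub_cancel, ← Grynkiewicz2009.apFinset_eq_reverse, ← hm]; exact hX
    · rw [hvb, hn, Nat.add_sub_cancel, ← Grynkiewicz2009.apFinset_eq_reverse, ← hn]; exact hY
    · rw [hua', hua, smul_neg, add_neg_cancel_right]
    · rw [hvb', hvb, smul_neg, add_neg_cancel_right]
    · rw [addOrderOf_neg]; exact hord
  · exact absurd (hua.trans hua'.symm) hne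

namespace Grynkiewicz2009

/-! ### The Klein group `K = H ∪ (d + H)` -/

section Klein

variable {K H : AddSubgroup G} {Kf Hf : Finset G} {d : G}

/-- Cosets as finsets: `c + K = c' + K` when `c ≡ c' (mod K)`. [cite: Grynkiewicz2009, §2] -/
theorem vadd_carrier_eq_of_sub_mem (hKf : ∀ g, g ∈ Kf ↔ g ∈ K) {c c' : G} (h : c - c' ∈ K) :
    c +ᵥ Kf = c' +ᵥ Kf := by
  rw [show c = c' + (c - c') by abel, ← vadd_vadd, vadd_finset_eq_of_forall_mem_iff hKf h]

/-- Membership in a coset finset. [cite: Grynkiewicz2009, §2] -/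
theorem mem_vadd_carrier_iff (hKf : ∀ g, g ∈ Kf ↔ g ∈ K) {c z : G} : z ∈ c +ᵥ Kf ↔ z - c ∈ K := by
  constructor
  · intro hz
    obtain ⟨k, hk, rfl⟩ := mem_vadd_finset.1 hz
    rw [vadd_eq_add, add_sub_cancel_left]; exact (hKf k).1 hk
  · intro hz
    exact mem_vadd_finset.2 ⟨z - c, (hKf _).2 hz, by rw [vadd_eq_add, add_sub_cancel]⟩

/-- `K = H ∪ (d + H)` for `|K| = 4`, `|H| = 2`, `H ≤ K`, `d ∈ K ∖ H`. [cite: Grynkiewicz2009, §6 Claim 5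
(«Let K = H × H′ ≅ ℤ/2ℤ × ℤ/2ℤ»)] -/
theorem mem_klein_iff (hKf : ∀ g, g ∈ Kf ↔ g ∈ K) (hHf : ∀ g, g ∈ Hf ↔ g ∈ H) (hKf4 : #Kf = 4)
    (hHf2 : #Hf = 2) (hHK : H ≤ K) (hdK : d ∈ K) (hdH : d ∉ H) (k : G) :
    k ∈ K ↔ k ∈ H ∨ k - d ∈ H := by
  have hsub : Hf ∪ (d +ᵥ Hf) ⊆ Kf := by
    intro z hz
    rcases mem_union.1 hz with hz | hz
    · exact (hKf z).2 (hHK ((hHf z).1 hz))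
    · obtain ⟨h, hh, rfl⟩ := mem_vadd_finset.1 hz
      exact (hKf _).2 (K.add_mem hdK (hHK ((hHf h).1 hh)))
  have hdisj : Disjoint Hf (d +ᵥ Hf) := by
    rw [disjoint_left]
    rintro z hz hz'
    rw [mem_vadd_carrier_iff hHf] at hz'
    exact hdH (by have := H.sub_mem ((hHf z).1 hz) hz'; rwa [sub_sub_cancel] at this)
  have heq : Hf ∪ (d +ᵥ Hf) = Kf :=
    eq_of_subset_of_card_le hsub (by rw [card_union_of_disjoint hdisj, card_vadd_finset, hHf2, hKf4])
  rw [← hKf, ← heq, mem_union, mem_vadd_carrier_iff hHf, hHf]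

end Klein

/-! ### The section argument -/

section Sections

variable {K H : AddSubgroup G} {Kf Hf S : Finset G} {d p₁ p₂ : G}

/-- **The section argument.**  Let `K` be a subgroup with carrier finset `Kf`, `|K| = 4`, `H ≤ K` with
carrier `Hf`, `d ∈ K ∖ H`.  A finite set `S` whose `K`-sections are `S ∩ (p₁ + K) = {p₁, p₁ + d}`,
`S ∩ (p₂ + K) = p₂ + H` (`p₁ ≢ p₂ (mod K)`) and, for every other `u ∈ S`, the full coset `u + K ⊆ S`,
is NOT periodic: a period `p` maps the section at `p₁` onto the section at `p + p₁`, which has size `2`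
only at `p₁ + K` (then `p ∈ {0, d}`, and `p = d` moves `p₂ + H`) and at `p₂ + K` (then `{p₁, p₁ + d} + p`
is an `H`-coset, so `d ∈ H`).  (`p₁ ≢ p₂ (mod K)` is implied: the two sections differ in shape.) [cite: Grynkiewicz2009, §4 (type (VIII): «A, B and A + B are aperiodic»)] -/
theorem not_isPeriodic_of_sections (hKf : ∀ g, g ∈ Kf ↔ g ∈ K) (hHf : ∀ g, g ∈ Hf ↔ g ∈ H)
    (hKf4 : #Kf = 4) (hdH : d ∉ H) (hd : d ≠ 0)
    (h1 : S ∩ (p₁ +ᵥ Kf) = {p₁, p₁ + d}) (h2 : S ∩ (p₂ +ᵥ Kf) = p₂ +ᵥ Hf)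
    (hfull : ∀ u ∈ S, u - p₁ ∉ K → u - p₂ ∉ K → u +ᵥ Kf ⊆ S) : ¬ IsPeriodic S := by
  rintro ⟨P, hP, hper⟩
  obtain ⟨p, hpP, hp0⟩ : ∃ p ∈ P, p ≠ (0 : G) := by
    by_contra hno
    push Not at hno
    exact hP ((AddSubgroup.eq_bot_iff_forall _).2 hno)
  have hpS : p +ᵥ S = S := hper p hpP
  have hp₁ : p₁ ∈ S := by
    have : p₁ ∈ S ∩ (p₁ +ᵥ Kf) := by rw [h1]; exact mem_insert_self _ _
    exact (mem_inter.1 this).1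
  have hpd : p₁ + d ∈ S := by
    have : p₁ + d ∈ S ∩ (p₁ +ᵥ Kf) := by rw [h1]; simp
    exact (mem_inter.1 this).1
  -- translating a section
  have sec : ∀ c : G, p +ᵥ (S ∩ (c +ᵥ Kf)) = S ∩ ((p + c) +ᵥ Kf) := fun c => by
    rw [vadd_finset_inter, hpS, vadd_vadd]
  have hpp₁ : p + p₁ ∈ S := by rw [← hpS]; exact vadd_mem_vadd_finset hp₁
  -- the section at `p + p₁` is `p + {p₁, p₁ + d}`
  have hsec₁ : S ∩ ((p + p₁) +ᵥ Kf) = {p + p₁, p + p₁ + d} := by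
    rw [← sec, h1, vadd_finset_insert, vadd_finset_singleton]
    simp only [vadd_eq_add]
    rw [← add_assoc]
  by_cases hpK : p ∈ K
  · -- the section at `p₁` is fixed: `p ∈ {0, d}`, so `p = d`; but `d` moves `p₂ + H`
    have hc : (p + p₁) +ᵥ Kf = p₁ +ᵥ Kf :=
      vadd_carrier_eq_of_sub_mem hKf (by rw [add_sub_cancel_right]; exact hpK)
    rw [hc, h1] at hsec₁
    have hmem : p + p₁ ∈ ({p₁, p₁ + d} : Finset G) := by rw [hsec₁]; exact mem_insert_self _ _
    rw [mem_insert, mem_singleton] at hmem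
    have hpd' : p = d := by
      rcases hmem with e | e
      · exact absurd (add_eq_right.1 e) hp0
      · exact add_right_cancel (e.trans (add_comm p₁ d))
    have hsec₂ : S ∩ ((p + p₂) +ᵥ Kf) = p +ᵥ (p₂ +ᵥ Hf) := by rw [← sec, h2]
    have hc2 : (p + p₂) +ᵥ Kf = p₂ +ᵥ Kf :=
      vadd_carrier_eq_of_sub_mem hKf (by rw [add_sub_cancel_right]; exact hpK)
    rw [hc2, h2] at hsec₂
    have : p + p₂ ∈ p₂ +ᵥ Hf := by
      rw [hsec₂]
      exact vadd_mem_vadd_finset (mem_vadd_finset.2 ⟨0, (hHf 0).2 H.zero_mem, by simp⟩)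
    rw [mem_vadd_carrier_iff hHf, add_sub_cancel_right, hpd'] at this
    exact hdH this
  · by_cases hq : (p + p₁) - p₂ ∈ K
    · -- the section at `p + p₁` is `p₂ + H`, so `d ∈ H`
      have hc : (p + p₁) +ᵥ Kf = p₂ +ᵥ Kf := vadd_carrier_eq_of_sub_mem hKf hq
      rw [hc, h2] at hsec₁
      have hm1 : p + p₁ ∈ p₂ +ᵥ Hf := by rw [hsec₁]; exact mem_insert_self _ _
      have hm2 : p + p₁ + d ∈ p₂ +ᵥ Hf := by rw [hsec₁]; simp
      rw [mem_vadd_carrier_iff hHf] at hm1 hm2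
      apply hdH
      have := H.sub_mem hm2 hm1
      rwa [show p + p₁ + d - p₂ - (p + p₁ - p₂) = d by abel] at this
    · -- a full coset of size `4` would be a section of size `2`
      have hsub := hfull _ hpp₁ (by rw [add_sub_cancel_right]; exact hpK) hq
      have hcard : #(S ∩ ((p + p₁) +ᵥ Kf)) = 4 := by
        rw [inter_eq_right.2 hsub, card_vadd_finset, hKf4]
      rw [hsec₁, card_pair (fun e => hd (add_eq_left.1 e.symm))] at hcard
      omega

/-- **`|S + K| = |S| + 4`** for a set with the sections above: the `K`-holes of `S` are the two in
`p₁ + K` and the two in `p₂ + K`. [cite: Grynkiewicz2009, §4 (type (VIII): «d⊆(A, A + K) = 4 … each of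
the 4 end terms … containing exactly 2 K-holes»)] -/
theorem card_add_carrier_of_sections (hKf : ∀ g, g ∈ Kf ↔ g ∈ K) (hHf : ∀ g, g ∈ Hf ↔ g ∈ H)
    (hKf4 : #Kf = 4) (hHf2 : #Hf = 2) (hd : d ≠ 0)
    (h1 : S ∩ (p₁ +ᵥ Kf) = {p₁, p₁ + d}) (h2 : S ∩ (p₂ +ᵥ Kf) = p₂ +ᵥ Hf) (h12 : p₁ - p₂ ∉ K)
    (hfull : ∀ u ∈ S, u - p₁ ∉ K → u - p₂ ∉ K → u +ᵥ Kf ⊆ S) :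
    #(S + Kf) = #S + 4 ∧ #((p₁ +ᵥ Kf) \ S) = 2 ∧ #((p₂ +ᵥ Kf) \ S) = 2 := by
  have h0K : (0 : G) ∈ Kf := (hKf 0).2 K.zero_mem
  have hSsub : S ⊆ S + Kf := subset_add_left S h0K
  -- the two hole counts
  have hx1 : #((p₁ +ᵥ Kf) \ S) = 2 := by
    have e : (p₁ +ᵥ Kf) \ S = (p₁ +ᵥ Kf) \ (S ∩ (p₁ +ᵥ Kf)) := by
      rw [sdiff_inter_self_right]
    have hsub : ({p₁, p₁ + d} : Finset G) ⊆ p₁ +ᵥ Kf := by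
      rw [← h1]; exact inter_subset_right
    rw [e, h1, card_sdiff_of_subset hsub, card_vadd_finset, hKf4,
      card_pair (fun e => hd (add_eq_left.1 e.symm))]
  have hx2 : #((p₂ +ᵥ Kf) \ S) = 2 := by
    have e : (p₂ +ᵥ Kf) \ S = (p₂ +ᵥ Kf) \ (S ∩ (p₂ +ᵥ Kf)) := by
      rw [sdiff_inter_self_right]
    have hsub : p₂ +ᵥ Hf ⊆ p₂ +ᵥ Kf := by rw [← h2]; exact inter_subset_right
    rw [e, h2, card_sdiff_of_subset hsub, card_vadd_finset, card_vadd_finset, hKf4, hHf2]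
  refine ⟨?_, hx1, hx2⟩
  -- the holes of `S` are exactly those
  have hp₁ : p₁ ∈ S := by
    have : p₁ ∈ S ∩ (p₁ +ᵥ Kf) := by rw [h1]; exact mem_insert_self _ _
    exact (mem_inter.1 this).1
  have hp₂ : p₂ ∈ S := by
    have : p₂ ∈ S ∩ (p₂ +ᵥ Kf) := by
      rw [h2]; exact mem_vadd_finset.2 ⟨0, (hHf 0).2 H.zero_mem, by simp⟩
    exact (mem_inter.1 this).1
  have holes : (S + Kf) \ S = ((p₁ +ᵥ Kf) \ S) ∪ ((p₂ +ᵥ Kf) \ S) := by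
    ext z
    simp only [mem_sdiff, mem_union]
    constructor
    · rintro ⟨hz, hzS⟩
      obtain ⟨u, hu, k, hk, rfl⟩ := mem_add.1 hz
      by_cases hu1 : u - p₁ ∈ K
      · left
        refine ⟨?_, hzS⟩
        rw [mem_vadd_carrier_iff hKf, show u + k - p₁ = (u - p₁) + k by abel]
        exact K.add_mem hu1 ((hKf k).1 hk)
      by_cases hu2 : u - p₂ ∈ K
      · right
        refine ⟨?_, hzS⟩
        rw [mem_vadd_carrier_iff hKf, show u + k - p₂ = (u - p₂) + k by abel]
        exact K.add_mem hu2 ((hKf k).1 hk)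
      · exact absurd (hfull u hu hu1 hu2 (vadd_mem_vadd_finset hk)) hzS
    · rintro (⟨hz, hzS⟩ | ⟨hz, hzS⟩)
      · obtain ⟨k, hk, rfl⟩ := mem_vadd_finset.1 hz
        exact ⟨mem_add.2 ⟨p₁, hp₁, k, hk, rfl⟩, hzS⟩
      · obtain ⟨k, hk, rfl⟩ := mem_vadd_finset.1 hz
        exact ⟨mem_add.2 ⟨p₂, hp₂, k, hk, rfl⟩, hzS⟩
  have hdisj : Disjoint ((p₁ +ᵥ Kf) \ S) ((p₂ +ᵥ Kf) \ S) := by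
    rw [disjoint_left]
    rintro z hz hz'
    rw [mem_sdiff, mem_vadd_carrier_iff hKf] at hz hz'
    exact h12 (by have := K.sub_mem hz'.1 hz.1; rwa [sub_sub_sub_cancel_left] at this)
  have := card_sdiff_add_card_eq_card hSsub
  rw [holes, card_union_of_disjoint hdisj, hx1, hx2] at this
  omega

end Sections

/-! ### Pulling a quasi-periodic decomposition of `φ_K(A)` back to `G` -/

section Pullback

variable {K H : AddSubgroup G} {Kf Hf A A₁' A₀' : Finset G} {d x a₀ : G}

/-- **One side of the pull-back.**  With the `K`-sections of `A` as in the frame (`{x, x + d}` at `x`,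
`a₀ + H` at `a₀`, full elsewhere) and a quasi-periodic decomposition `φ_K(A) = X₁ ∪ X₀` in `G ⧸ K`
(quasi-period `M`) with `φ_K(x), φ_K(a₀) ∈ X₀`: the preimage parts `A₁' = {a ∈ A : φ_K(a) ∈ X₁}`,
`A₀' = {a ∈ A : φ_K(a) ∈ X₀}` form a quasi-periodic decomposition of `A` with quasi-period
`N = φ_K⁻¹(M)` (the periodic part is a union of full `K`-cosets), `A₀'` has the same two small
`K`-sections and full cosets elsewhere, and `φ_K(A₀') = X₀`. [cite: Grynkiewicz2009, §6 Claim 5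
(p. 26, «Thus the theorem holds with type (VIII)»)] -/
theorem pullback_side [DecidableEq (G ⧸ K)] (hKf : ∀ g, g ∈ Kf ↔ g ∈ K)
    (hAx : A ∩ (x +ᵥ Kf) = {x, x + d})
    (hAa : A ∩ (a₀ +ᵥ Kf) = a₀ +ᵥ Hf)
    (hAfull : ∀ u ∈ A, u - x ∉ K → u - a₀ ∉ K → u +ᵥ Kf ⊆ A)
    {M : AddSubgroup (G ⧸ K)} {X₁ X₀ : Finset (G ⧸ K)}
    (hdec : IsQuasiPeriodicDecomp M (A.image (QuotientAddGroup.mk : G → G ⧸ K)) X₁ X₀)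
    (hxX₀ : (QuotientAddGroup.mk x : G ⧸ K) ∈ X₀) (haX₀ : (QuotientAddGroup.mk a₀ : G ⧸ K) ∈ X₀)
    (hA₁' : A₁' = A.filter fun a => (QuotientAddGroup.mk a : G ⧸ K) ∈ X₁)
    (hA₀' : A₀' = A.filter fun a => (QuotientAddGroup.mk a : G ⧸ K) ∈ X₀) :
    IsQuasiPeriodicDecomp (M.comap (QuotientAddGroup.mk' K)) A A₁' A₀' ∧
      A₀' ⊆ A ∧ A₀' ∩ (x +ᵥ Kf) = {x, x + d} ∧ A₀' ∩ (a₀ +ᵥ Kf) = a₀ +ᵥ Hf ∧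
      (∀ u ∈ A₀', u - x ∉ K → u - a₀ ∉ K → u +ᵥ Kf ⊆ A₀') ∧
      A₀'.image (QuotientAddGroup.mk : G → G ⧸ K) = X₀ := by
  have hπsub : ∀ u v : G, (QuotientAddGroup.mk u : G ⧸ K) = QuotientAddGroup.mk v ↔ u - v ∈ K :=
    fun u v => QuotientAddGroup.eq_iff_sub_mem
  have hπK : ∀ u k : G, k ∈ K → (QuotientAddGroup.mk (u + k) : G ⧸ K) = QuotientAddGroup.mk u :=
    fun u k hk => (hπsub _ _).2 (by rw [add_sub_cancel_left]; exact hk)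
  have memA₀ : ∀ {u : G}, u ∈ A₀' ↔ u ∈ A ∧ (QuotientAddGroup.mk u : G ⧸ K) ∈ X₀ := by
    intro u; rw [hA₀', mem_filter]
  have memA₁ : ∀ {u : G}, u ∈ A₁' ↔ u ∈ A ∧ (QuotientAddGroup.mk u : G ⧸ K) ∈ X₁ := by
    intro u; rw [hA₁', mem_filter]
  have hA₀A : A₀' ⊆ A := fun u hu => (memA₀.1 hu).1
  -- sections of `A₀'`
  have secx : A₀' ∩ (x +ᵥ Kf) = {x, x + d} := by
    rw [← hAx]
    ext u
    simp only [mem_inter, memA₀]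
    constructor
    · rintro ⟨⟨hu, -⟩, hu'⟩; exact ⟨hu, hu'⟩
    · rintro ⟨hu, hu'⟩
      refine ⟨⟨hu, ?_⟩, hu'⟩
      rw [(hπsub u x).2 ((mem_vadd_carrier_iff hKf).1 hu')]; exact hxX₀
  have seca : A₀' ∩ (a₀ +ᵥ Kf) = a₀ +ᵥ Hf := by
    rw [← hAa]
    ext u
    simp only [mem_inter, memA₀]
    constructor
    · rintro ⟨⟨hu, -⟩, hu'⟩; exact ⟨hu, hu'⟩
    · rintro ⟨hu, hu'⟩
      refine ⟨⟨hu, ?_⟩, hu'⟩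
      rw [(hπsub u a₀).2 ((mem_vadd_carrier_iff hKf).1 hu')]; exact haX₀
  have fullA₀ : ∀ u ∈ A₀', u - x ∉ K → u - a₀ ∉ K → u +ᵥ Kf ⊆ A₀' := by
    intro u hu hux hua z hz
    obtain ⟨k, hk, rfl⟩ := mem_vadd_finset.1 hz
    refine memA₀.2 ⟨hAfull u (hA₀A hu) hux hua (vadd_mem_vadd_finset hk), ?_⟩
    rw [vadd_eq_add, hπK u k ((hKf k).1 hk)]; exact (memA₀.1 hu).2
  -- elements of `A₁'` sit in full cosets
  have fullA₁ : ∀ u ∈ A₁', u +ᵥ Kf ⊆ A := by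
    intro u hu
    obtain ⟨huA, huX₁⟩ := memA₁.1 hu
    refine hAfull u huA (fun h => ?_) (fun h => ?_)
    · exact disjoint_left.1 hdec.disjoint huX₁ (by rw [(hπsub u x).2 h]; exact hxX₀)
    · exact disjoint_left.1 hdec.disjoint huX₁ (by rw [(hπsub u a₀).2 h]; exact haX₀)
  have himg : A₀'.image (QuotientAddGroup.mk : G → G ⧸ K) = X₀ := by
    ext w
    constructor
    · intro hw
      obtain ⟨u, hu, rfl⟩ := mem_image.1 hw
      exact (memA₀.1 hu).2
    · intro hw
      obtain ⟨u, hu, rfl⟩ := mem_image.1 (hdec.right_subset hw)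
      exact mem_image_of_mem _ (memA₀.2 ⟨hu, hw⟩)
  refine ⟨⟨?_, ?_, ?_, ?_, ?_⟩, hA₀A, secx, seca, fullA₀, himg⟩
  · -- `N ≠ ⊥`
    intro hN
    apply hdec.ne_bot
    refine (AddSubgroup.eq_bot_iff_forall M).2 fun q hq => ?_
    obtain ⟨g, rfl⟩ := QuotientAddGroup.mk_surjective q
    have hg : g ∈ M.comap (QuotientAddGroup.mk' K) := by rw [AddSubgroup.mem_comap]; exact hq
    rw [hN, AddSubgroup.mem_bot] at hg
    rw [hg, QuotientAddGroup.mk_zero]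
  · rw [hA₁', hA₀', disjoint_filter]
    intro u _ h1 h0
    exact disjoint_left.1 hdec.disjoint h1 h0
  · rw [hA₁', hA₀', ← filter_or]
    refine filter_eq_self.2 fun u hu => ?_
    rw [← mem_union, hdec.union_eq]; exact mem_image_of_mem _ hu
  · -- `A₁'` is `N`-periodic
    intro g hg
    apply eq_of_subset_of_card_le _ (by rw [card_vadd_finset])
    intro z hz
    obtain ⟨u, hu, rfl⟩ := mem_vadd_finset.1 hz
    obtain ⟨huA, huX₁⟩ := memA₁.1 hu
    rw [AddSubgroup.mem_comap, QuotientAddGroup.mk'_apply] at hg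
    have hgu : (QuotientAddGroup.mk (g + u) : G ⧸ K) ∈ X₁ := by
      rw [QuotientAddGroup.mk_add]; exact hdec.periodic.add_mem hg huX₁
    obtain ⟨a', ha', he⟩ := mem_image.1 (hdec.left_subset hgu)
    have ha'₁ : a' ∈ A₁' := memA₁.2 ⟨ha', by rw [he]; exact hgu⟩
    refine memA₁.2 ⟨fullA₁ a' ha'₁ ((mem_vadd_carrier_iff hKf).2 ?_), hgu⟩
    rw [← hπsub]; exact he.symm
  · intro u hu v hv
    rw [AddSubgroup.mem_comap, QuotientAddGroup.mk'_apply, QuotientAddGroup.mk_sub]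
    exact hdec.sub_mem _ (memA₀.1 hu).2 _ (memA₀.1 hv).2

end Pullback

/-! ### The type (VIII) decomposition -/

section TypeEight

variable {K H : AddSubgroup G} {Kf Hf A B : Finset G} {d x y a₀ b₀ : G}

/-- **Type (I) ⟹ type (VIII): the decomposition of Theorem 4.1** («applying KST modulo `L = K`, it
follows that we must have type (II) with (by appropriate choice of sign) both `φ_L(aᵢ)` and `φ_L(bᵢ)`
the first term in their respective arithmetic progression, and both `φ_L(A₀′)` and `φ_L(B₀′)` the last
term … Thus the theorem holds with type (VIII)»).  DATA (the print's `G`, after the `l = 4` analysis):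
the Klein group `K ⊇ H` (`|K| = 4`, `|H| = 2`, `2K = 0`, `d ∈ K ∖ H`); `x, a₀ ∈ A`, `y, b₀ ∈ B` with
`K`-sections `A ∩ (x + K) = {x, x + d}`, `A ∩ (a₀ + K) = a₀ + H`, `B ∩ (y + K) = {y, y + d}`,
`B ∩ (b₀ + K) = b₀ + H`, all other `K`-cosets of `A`, `B` full; `x ≢ a₀`, `y ≢ b₀ (mod K)`;
`φ_K(x + y)` and `φ_K(a₀ + b₀)` uniquely expressed in `φ_K(A) + φ_K(B)` (elementwise mod `K`); and
`|φ_K(A + B)| + 1 = |φ_K(A)| + |φ_K(B)|`.  CONCLUSION: quasi-periodic decompositions of `A`, `B` with a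
common quasi-period `N` satisfying (i), (ii) of Theorem 4.1 and (iii) with a bottom pair of type
(VIII) (`IsGrynkiewiczDecomp` + `IsTypeVIII`).  Road in the module docstring.
[cite: Grynkiewicz2009, §6 Claim 5 (p. 26, type (I) ⟹ type (VIII)); §4 (type (VIII)); §2 (KST (iii))] -/
theorem exists_isGrynkiewiczDecomp_typeVIII [Fintype G]
    (hKf : ∀ g, g ∈ Kf ↔ g ∈ K) (hHf : ∀ g, g ∈ Hf ↔ g ∈ H) (hKf4 : #Kf = 4) (hHf2 : #Hf = 2)
    (hHK : H ≤ K) (hK2 : ∀ k ∈ K, k + k = 0) (hdK : d ∈ K) (hdH : d ∉ H)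
    (hx : x ∈ A) (hy : y ∈ B) (ha₀ : a₀ ∈ A) (hb₀ : b₀ ∈ B)
    (hAx : A ∩ (x +ᵥ Kf) = {x, x + d}) (hAa : A ∩ (a₀ +ᵥ Kf) = a₀ +ᵥ Hf)
    (hAfull : ∀ u ∈ A, u - x ∉ K → u - a₀ ∉ K → u +ᵥ Kf ⊆ A)
    (hBy : B ∩ (y +ᵥ Kf) = {y, y + d}) (hBb : B ∩ (b₀ +ᵥ Kf) = b₀ +ᵥ Hf)
    (hBfull : ∀ v ∈ B, v - y ∉ K → v - b₀ ∉ K → v +ᵥ Kf ⊆ B)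
    (hxa : x - a₀ ∉ K) (hyb : y - b₀ ∉ K)
    (hKxy : ∀ u ∈ A, ∀ v ∈ B, u + v - (x + y) ∈ K → u - x ∈ K ∧ v - y ∈ K)
    (hKab : ∀ u ∈ A, ∀ v ∈ B, u + v - (a₀ + b₀) ∈ K → u - a₀ ∈ K ∧ v - b₀ ∈ K)
    (hii : cosetCount K (A + B) + 1 = cosetCount K A + cosetCount K B) :
    ∃ (N : AddSubgroup G) (A₁ A₀ B₁ B₀ : Finset G),
      IsGrynkiewiczDecomp N A B A₁ A₀ B₁ B₀ ∧ IsTypeVIII A₀ B₀ := by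
  haveI : DecidableEq (G ⧸ K) := Classical.decEq _
  haveI : Fintype (G ⧸ K) := Fintype.ofFinite _
  set π : G → G ⧸ K := QuotientAddGroup.mk with hπ
  have hπsub : ∀ u v : G, π u = π v ↔ u - v ∈ K := fun u v => QuotientAddGroup.eq_iff_sub_mem
  have hd0 : d ≠ 0 := fun h => hdH (by rw [h]; exact H.zero_mem)
  have hdd : d + d = 0 := hK2 d hdK
  have h0K : (0 : G) ∈ Kf := (hKf 0).2 K.zero_mem
  haveI : Nontrivial (G ⧸ K) := nontrivial_of_ne (π x) (π a₀) fun e => hxa ((hπsub _ _).1 e)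
  -- (1) the image pair is critical
  have hcrit : #(A.image π + B.image π) + 1 = #(A.image π) + #(B.image π) := by
    rw [← image_mk_add_eq, ← cosetCount_eq_card_image, ← cosetCount_eq_card_image,
      ← cosetCount_eq_card_image, hii]
  -- (2) the two unique expression elements
  have huniq : ∀ {p q : G}, (∀ u ∈ A, ∀ v ∈ B, u + v - (p + q) ∈ K → u - p ∈ K ∧ v - q ∈ K) →
      p ∈ A → q ∈ B → (A.image π).addConvolution (B.image π) (π p + π q) = 1 := by
    intro p q hKpq hp hq
    rw [addConvolution_add_eq_one_iff (mem_image_of_mem _ hp) (mem_image_of_mem _ hq)]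
    intro ξ hξ η hη he
    obtain ⟨u, hu, rfl⟩ := mem_image.1 hξ
    obtain ⟨v, hv, rfl⟩ := mem_image.1 hη
    rw [hπ, ← QuotientAddGroup.mk_add, ← QuotientAddGroup.mk_add, QuotientAddGroup.eq_iff_sub_mem] at he
    exact (hπsub v q).2 (hKpq u hu v hv he).2
  have hu1 : (A.image π).addConvolution (B.image π) (π x + π y) = 1 := huniq hKxy hx hy
  have hu0 : (A.image π).addConvolution (B.image π) (π a₀ + π b₀) = 1 := huniq hKab ha₀ hb₀
  -- (3) KST with (iii) in `G ⧸ K`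
  have hAne : (A.image π).Nonempty := ⟨π x, mem_image_of_mem _ hx⟩
  have hBne : (B.image π).Nonempty := ⟨π y, mem_image_of_mem _ hy⟩
  obtain ⟨M, X₁, X₀, Y₁, Y₀, hq⟩ := exists_isKempermanDecomp hAne hBne hcrit (Or.inr ⟨_, hu1⟩)
  -- (4) both unique expression elements lie in the bottom pair, which is of type (II)
  obtain ⟨hxX₀, hyY₀⟩ := hq.mem_of_unique _ (mem_image_of_mem π hx) _ (mem_image_of_mem π hy) hu1
  obtain ⟨haX₀, hbY₀⟩ := hq.mem_of_unique _ (mem_image_of_mem π ha₀) _ (mem_image_of_mem π hb₀) hu0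
  have hπxa : π x ≠ π a₀ := fun e => hxa ((hπsub x a₀).1 e)
  have hπyb : π y ≠ π b₀ := fun e => hyb ((hπsub y b₀).1 e)
  have restrict : ∀ {c : G ⧸ K}, (A.image π).addConvolution (B.image π) c = 1 → c ∈ X₀ + Y₀ →
      X₀.addConvolution Y₀ c = 1 := by
    intro c hc hcmem
    apply le_antisymm
    · rw [← hc]; exact addConvolution_mono hq.decomp_left.right_subset hq.decomp_right.right_subset _
    · exact addConvolution_pos.2 hcmem
  have hu1' := restrict hu1 (add_mem_add hxX₀ hyY₀)
  have hu0' := restrict hu0 (add_mem_add haX₀ hbY₀)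
  have hII : IsElementaryII X₀ Y₀ := by
    rcases hq.elementary with hI | hII | hIII | hIV
    · exfalso
      rcases hI.2.2 with h1 | h1
      · obtain ⟨z, hz⟩ := card_eq_one.1 h1
        rw [hz, mem_singleton] at hxX₀ haX₀
        exact hπxa (hxX₀.trans haX₀.symm)
      · obtain ⟨z, hz⟩ := card_eq_one.1 h1
        rw [hz, mem_singleton] at hyY₀ hbY₀
        exact hπyb (hyY₀.trans hbY₀.symm)
    · exact hII
    · exfalso
      obtain ⟨Q, p, q, -, -, -, -, -, huq⟩ := hIII
      have e : π a₀ + π b₀ = π x + π y := ((huq _).1 hu0').trans ((huq _).1 hu1').symm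
      rw [hπ, ← QuotientAddGroup.mk_add, ← QuotientAddGroup.mk_add, QuotientAddGroup.eq_iff_sub_mem] at e
      have := K.neg_mem (hKxy a₀ ha₀ b₀ hb₀ e).1
      rw [neg_sub] at this
      exact hxa this
    · exfalso
      obtain ⟨Q, p, q, g, -, -, -, -, hno, -⟩ := hIV
      exact hno _ hu1'
  have hm2 : 2 ≤ #X₀ := hII.1
  have hn2 : 2 ≤ #Y₀ := hII.2.1
  obtain ⟨e, hX₀, hY₀, hπa₀, hπb₀, hord⟩ :=
    hII.exists_apFinset_of_two_unique hxX₀ hyY₀ haX₀ hbY₀ hπxa hu1' hu0'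
  set m := #X₀ with hm
  set n := #Y₀ with hn
  have hcardX : #(apFinset (π x) e m) = m := by rw [← hX₀]
  have hcardY : #(apFinset (π y) e n) = n := by rw [← hY₀]
  have hordS : addOrderOf e = 0 ∨ m + n - 1 ≤ addOrderOf e := hord
  have hcardS : #(apFinset (π x + π y) e (m + n - 1)) = m + n - 1 :=
    card_apFinset_of_addOrderOf _ _ hordS
  -- (5) the pull-back
  obtain ⟨eG, heG⟩ := QuotientAddGroup.mk_surjective e
  have heG' : π eG = e := heG
  set N : AddSubgroup G := M.comap (QuotientAddGroup.mk' K) with hNdef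
  have hmemN : ∀ g, g ∈ N ↔ π g ∈ M := fun g => by rw [hNdef, AddSubgroup.mem_comap]; rfl
  set A₁' := A.filter (fun a => π a ∈ X₁) with hA₁'
  set A₀' := A.filter (fun a => π a ∈ X₀) with hA₀'
  set B₁' := B.filter (fun b => π b ∈ Y₁) with hB₁'
  set B₀' := B.filter (fun b => π b ∈ Y₀) with hB₀'
  obtain ⟨hdecA, hA₀A, secx, seca, fullA₀, himgA⟩ :=
    pullback_side hKf hAx hAa hAfull hq.decomp_left hxX₀ haX₀ hA₁' hA₀'
  obtain ⟨hdecB, hB₀B, secy, secb, fullB₀, himgB⟩ :=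
    pullback_side hKf hBy hBb hBfull hq.decomp_right hyY₀ hbY₀ hB₁' hB₀'
  have memA₀ : ∀ {u : G}, u ∈ A₀' ↔ u ∈ A ∧ π u ∈ X₀ := by intro u; rw [hA₀', mem_filter]
  have memB₀ : ∀ {v : G}, v ∈ B₀' ↔ v ∈ B ∧ π v ∈ Y₀ := by intro v; rw [hB₀', mem_filter]
  have hxA₀ : x ∈ A₀' := memA₀.2 ⟨hx, hxX₀⟩
  have haA₀ : a₀ ∈ A₀' := memA₀.2 ⟨ha₀, haX₀⟩
  have hyB₀ : y ∈ B₀' := memB₀.2 ⟨hy, hyY₀⟩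
  have hbB₀ : b₀ ∈ B₀' := memB₀.2 ⟨hb₀, hbY₀⟩
  have hxdA₀ : x + d ∈ A₀' := by
    have : x + d ∈ A₀' ∩ (x +ᵥ Kf) := by rw [secx]; simp
    exact (mem_inter.1 this).1
  have hydB₀ : y + d ∈ B₀' := by
    have : y + d ∈ B₀' ∩ (y +ᵥ Kf) := by rw [secy]; simp
    exact (mem_inter.1 this).1
  have haHA₀ : ∀ h ∈ H, a₀ + h ∈ A₀' := fun h hh => by
    have : a₀ + h ∈ A₀' ∩ (a₀ +ᵥ Kf) := by rw [seca]; exact mem_vadd_finset.2 ⟨h, (hHf h).2 hh, rfl⟩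
    exact (mem_inter.1 this).1
  have hbHB₀ : ∀ h ∈ H, b₀ + h ∈ B₀' := fun h hh => by
    have : b₀ + h ∈ B₀' ∩ (b₀ +ᵥ Kf) := by rw [secb]; exact mem_vadd_finset.2 ⟨h, (hHf h).2 hh, rfl⟩
    exact (mem_inter.1 this).1
  have hklein := mem_klein_iff hKf hHf hKf4 hHf2 hHK hdK hdH
  -- (6) the sections of `A₀' + B₀'`
  have sum1 : (A₀' + B₀') ∩ ((x + y) +ᵥ Kf) = {x + y, x + y + d} := by
    ext w
    simp only [mem_inter, mem_insert, mem_singleton]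
    constructor
    · rintro ⟨hw, hwK⟩
      obtain ⟨u, hu, v, hv, rfl⟩ := mem_add.1 hw
      rw [mem_vadd_carrier_iff hKf] at hwK
      obtain ⟨huK, hvK⟩ := hKxy u (hA₀A hu) v (hB₀B hv) hwK
      have hu' : u ∈ A₀' ∩ (x +ᵥ Kf) := mem_inter.2 ⟨hu, (mem_vadd_carrier_iff hKf).2 huK⟩
      have hv' : v ∈ B₀' ∩ (y +ᵥ Kf) := mem_inter.2 ⟨hv, (mem_vadd_carrier_iff hKf).2 hvK⟩
      rw [secx, mem_insert, mem_singleton] at hu'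
      rw [secy, mem_insert, mem_singleton] at hv'
      rcases hu' with hu' | hu' <;> rcases hv' with hv' | hv' <;> rw [hu', hv']
      · exact Or.inl rfl
      · exact Or.inr (add_assoc _ _ _).symm
      · exact Or.inr (add_right_comm _ _ _)
      · exact Or.inl (by rw [add_add_add_comm, hdd, add_zero])
    · rintro (rfl | rfl)
      · exact ⟨add_mem_add hxA₀ hyB₀, mem_vadd_finset.2 ⟨0, h0K, by simp⟩⟩
      · refine ⟨?_, (mem_vadd_carrier_iff hKf).2 (by rw [add_sub_cancel_left]; exact hdK)⟩
        rw [add_assoc]; exact add_mem_add hxA₀ hydB₀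
  have sum0 : (A₀' + B₀') ∩ ((a₀ + b₀) +ᵥ Kf) = (a₀ + b₀) +ᵥ Hf := by
    ext w
    constructor
    · intro hw
      obtain ⟨hw, hwK⟩ := mem_inter.1 hw
      obtain ⟨u, hu, v, hv, rfl⟩ := mem_add.1 hw
      rw [mem_vadd_carrier_iff hKf] at hwK
      obtain ⟨huK, hvK⟩ := hKab u (hA₀A hu) v (hB₀B hv) hwK
      have hu' : u ∈ a₀ +ᵥ Hf := by
        rw [← seca]; exact mem_inter.2 ⟨hu, (mem_vadd_carrier_iff hKf).2 huK⟩
      have hv' : v ∈ b₀ +ᵥ Hf := by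
        rw [← secb]; exact mem_inter.2 ⟨hv, (mem_vadd_carrier_iff hKf).2 hvK⟩
      rw [mem_vadd_carrier_iff hHf] at hu' hv' ⊢
      rw [show u + v - (a₀ + b₀) = (u - a₀) + (v - b₀) by abel]
      exact H.add_mem hu' hv'
    · intro hw
      rw [mem_vadd_carrier_iff hHf] at hw
      refine mem_inter.2 ⟨?_, (mem_vadd_carrier_iff hKf).2 (hHK hw)⟩
      have := add_mem_add haA₀ (hbHB₀ _ hw)
      rwa [show a₀ + (b₀ + (w - (a₀ + b₀))) = w by abel] at this
  -- lifting terms of the progressions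
  have liftA : ∀ i, 1 ≤ i → i + 2 ≤ m → ∃ u ∈ A₀', π u = π x + i • e ∧ u +ᵥ Kf ⊆ A₀' := by
    intro i hi1 hi2
    have hmem : π x + i • e ∈ X₀ := by rw [hX₀]; exact mem_apFinset.2 ⟨i, by omega, rfl⟩
    obtain ⟨u, hu, hπu⟩ := mem_image.1 (by rw [himgA]; exact hmem)
    refine ⟨u, hu, hπu, fullA₀ u hu (fun h => ?_) (fun h => ?_)⟩
    · have e0 : π x + i • e = π x + 0 • e := by rw [zero_nsmul, add_zero, ← hπu]; exact (hπsub u x).2 h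
      have := nsmul_injOn_of_card_apFinset hcardX (by omega) (by omega) e0
      omega
    · have e0 : π x + i • e = π x + (m - 1) • e := by rw [← hπa₀, ← hπu]; exact (hπsub u a₀).2 h
      have := nsmul_injOn_of_card_apFinset hcardX (by omega) (by omega) e0
      omega
  have liftB : ∀ j, 1 ≤ j → j + 2 ≤ n → ∃ v ∈ B₀', π v = π y + j • e ∧ v +ᵥ Kf ⊆ B₀' := by
    intro j hj1 hj2
    have hmem : π y + j • e ∈ Y₀ := by rw [hY₀]; exact mem_apFinset.2 ⟨j, by omega, rfl⟩
    obtain ⟨v, hv, hπv⟩ := mem_image.1 (by rw [himgB]; exact hmem)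
    refine ⟨v, hv, hπv, fullB₀ v hv (fun h => ?_) (fun h => ?_)⟩
    · have e0 : π y + j • e = π y + 0 • e := by rw [zero_nsmul, add_zero, ← hπv]; exact (hπsub v y).2 h
      have := nsmul_injOn_of_card_apFinset hcardY (by omega) (by omega) e0
      omega
    · have e0 : π y + j • e = π y + (n - 1) • e := by rw [← hπb₀, ← hπv]; exact (hπsub v b₀).2 h
      have := nsmul_injOn_of_card_apFinset hcardY (by omega) (by omega) e0
      omega
  -- a translate of a full coset inside the sumset
  have cosetA : ∀ {u v : G}, u +ᵥ Kf ⊆ A₀' → v ∈ B₀' → ∀ {w : G}, π w = π u + π v →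
      w +ᵥ Kf ⊆ A₀' + B₀' := by
    intro u v hu hv w hw z hz
    rw [hπ, ← QuotientAddGroup.mk_add, QuotientAddGroup.eq_iff_sub_mem] at hw
    rw [mem_vadd_carrier_iff hKf] at hz
    have hzK : z - v - u ∈ K := by
      rw [show z - v - u = (z - w) + (w - (u + v)) by abel]; exact K.add_mem hz hw
    have hzu : z - v ∈ u +ᵥ Kf := (mem_vadd_carrier_iff hKf).2 hzK
    have := add_mem_add (hu hzu) hv
    rwa [sub_add_cancel] at this
  have cosetB : ∀ {u v : G}, u ∈ A₀' → v +ᵥ Kf ⊆ B₀' → ∀ {w : G}, π w = π u + π v →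
      w +ᵥ Kf ⊆ A₀' + B₀' := by
    intro u v hu hv w hw z hz
    rw [hπ, ← QuotientAddGroup.mk_add, QuotientAddGroup.eq_iff_sub_mem] at hw
    rw [mem_vadd_carrier_iff hKf] at hz
    have hzK : z - u - v ∈ K := by
      rw [show z - u - v = (z - w) + (w - (u + v)) by abel]; exact K.add_mem hz hw
    have hzv : z - u ∈ v +ᵥ Kf := (mem_vadd_carrier_iff hKf).2 hzK
    have := add_mem_add hu (hv hzv)
    rwa [add_sub_cancel] at this
  have fullsum : ∀ w ∈ A₀' + B₀', w - (x + y) ∉ K → w - (a₀ + b₀) ∉ K → w +ᵥ Kf ⊆ A₀' + B₀' := by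
    intro w hw hw1 hw0
    have hπw : π w ∈ X₀ + Y₀ := by
      obtain ⟨u, hu, v, hv, rfl⟩ := mem_add.1 hw
      rw [hπ, QuotientAddGroup.mk_add]
      exact add_mem_add (memA₀.1 hu).2 (memB₀.1 hv).2
    rw [hX₀, hY₀, Isoperimetric.apFinset_add_apFinset _ _ _ (by omega) (by omega)] at hπw
    obtain ⟨j, hj, hjw⟩ := mem_apFinset.1 hπw
    have hj0 : j ≠ 0 := by
      rintro rfl
      apply hw1
      rw [zero_nsmul, add_zero] at hjw
      rw [← hπsub, hπ, QuotientAddGroup.mk_add]; exact hjw.symm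
    have hjl : j ≠ m + n - 2 := by
      rintro rfl
      apply hw0
      rw [← hπsub, ← hjw, hπ, QuotientAddGroup.mk_add]
      change π x + π y + (m + n - 2) • e = π a₀ + π b₀
      rw [hπa₀, hπb₀, show m + n - 2 = (m - 1) + (n - 1) by omega, add_nsmul]
      abel
    by_cases hjn : j + 2 ≤ n
    · -- `j` is a middle index of `Y₀`
      obtain ⟨v, hv, hπv, hvK⟩ := liftB j (by omega) hjn
      exact cosetB hxA₀ hvK (by rw [hπv, ← add_assoc, hjw])
    by_cases hjn' : j + 1 = n
    · -- `w ≡ x + b₀`: the coset `x + b₀ + K = {x, x + d} + (b₀ + H)`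
      have hw' : w - (x + b₀) ∈ K := by
        rw [← hπsub, ← hjw, hπ, QuotientAddGroup.mk_add]
        change π x + π y + j • e = π x + π b₀
        rw [hπb₀, show n - 1 = j by omega, add_assoc]
      intro z hz
      rw [mem_vadd_carrier_iff hKf] at hz
      have hk : z - (x + b₀) ∈ K := by
        rw [show z - (x + b₀) = (z - w) + (w - (x + b₀)) by abel]; exact K.add_mem hz hw'
      rcases (hklein _).1 hk with h | h
      · have := add_mem_add hxA₀ (hbHB₀ _ h)
        rwa [show x + (b₀ + (z - (x + b₀))) = z by abel] at this
      · have := add_mem_add hxdA₀ (hbHB₀ _ h)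
        rwa [show x + d + (b₀ + (z - (x + b₀) - d)) = z by abel] at this
    · -- `j ≥ n`: `i = j - (n - 1)` is a middle index of `X₀`
      obtain ⟨u, hu, hπu, huK⟩ := liftA (j - (n - 1)) (by omega) (by omega)
      refine cosetA huK hbB₀ ?_
      rw [hπu, hπb₀, ← hjw, add_add_add_comm, ← add_nsmul]
      congr 2; omega
  -- (7) aperiodicity and the hole counts, by sections
  have hA₀ap : ¬ IsPeriodic A₀' := not_isPeriodic_of_sections hKf hHf hKf4 hdH hd0 secx seca fullA₀
  have hB₀ap : ¬ IsPeriodic B₀' := not_isPeriodic_of_sections hKf hHf hKf4 hdH hd0 secy secb fullB₀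
  have hABap : ¬ IsPeriodic (A₀' + B₀') :=
    not_isPeriodic_of_sections hKf hHf hKf4 hdH hd0 sum1 sum0 fullsum
  obtain ⟨hcardA, hholeA1, hholeA2⟩ :=
    card_add_carrier_of_sections hKf hHf hKf4 hHf2 hd0 secx seca hxa fullA₀
  obtain ⟨hcardB, hholeB1, hholeB2⟩ :=
    card_add_carrier_of_sections hKf hHf hKf4 hHf2 hd0 secy secb hyb fullB₀
  -- (8) the progressions `A₀' + K = {x, x + eG, …} + K`
  have himg_ap : ∀ (a : G) (k : ℕ), (apFinset a eG k).image π = apFinset (π a) e k := by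
    intro a k
    rw [hπ, ← QuotientAddGroup.coe_mk', image_apFinset]
    simp only [QuotientAddGroup.mk'_apply]
    rw [heG]
  have hAK : A₀' + Kf = apFinset x eG m + Kf := by
    ext z
    rw [mem_add_carrier_iff_image_mk hKf, mem_add_carrier_iff_image_mk hKf, himgA, himg_ap, ← hX₀]
  have hBK : B₀' + Kf = apFinset y eG n + Kf := by
    ext z
    rw [mem_add_carrier_iff_image_mk hKf, mem_add_carrier_iff_image_mk hKf, himgB, himg_ap, ← hY₀]
  have hsumK : #(apFinset (x + y) eG (m + n - 1) + Kf) = 4 * (m + n - 1) := by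
    rw [card_eq_cosetCount_mul hKf (isPeriodicWith_add_of_forall_mem_iff hKf _),
      cosetCount_add_carrier hKf, cosetCount_eq_card_image, himg_ap, hKf4]
    rw [show π (x + y) = π x + π y by rw [hπ, QuotientAddGroup.mk_add], hcardS, mul_comm]
  have hlastA : ((x + (m - 1) • eG) +ᵥ Kf) = a₀ +ᵥ Kf := by
    refine vadd_carrier_eq_of_sub_mem hKf ((hπsub _ _).1 ?_)
    rw [hπ, QuotientAddGroup.mk_add, QuotientAddGroup.mk_nsmul]
    change π x + (m - 1) • π eG = π a₀
    rw [heG', hπa₀]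
  have hlastB : ((y + (n - 1) • eG) +ᵥ Kf) = b₀ +ᵥ Kf := by
    refine vadd_carrier_eq_of_sub_mem hKf ((hπsub _ _).1 ?_)
    rw [hπ, QuotientAddGroup.mk_add, QuotientAddGroup.mk_nsmul]
    change π y + (n - 1) • π eG = π b₀
    rw [heG', hπb₀]
  have hVIII : IsTypeVIII A₀' B₀' := by
    refine ⟨hA₀ap, hB₀ap, hABap, K, Kf, hKf, hKf4, hK2, x, y, eG, m, n, hxA₀, hyB₀, hm2, hn2, hAK, hBK,
      hsumK, hcardA, hcardB, hholeA1, ?_, hholeB1, ?_⟩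
    · rw [hlastA]; exact hholeA2
    · rw [hlastB]; exact hholeB2
  -- (9) the decomposition
  refine ⟨N, A₁', A₀', B₁', B₀', ?_, hVIII⟩
  exact
    { decomp_left := hdecA
      decomp_right := hdecB
      left_nonempty := ⟨x, hxA₀⟩
      right_nonempty := ⟨y, hyB₀⟩
      quot_unique := by
        intro a ha b hb p hp q hq' hab
        rw [hmemN, hπ, QuotientAddGroup.mk_sub, QuotientAddGroup.mk_add, QuotientAddGroup.mk_add] at hab
        have h' := hq.quot_unique _ (mem_image_of_mem _ ha) _ (mem_image_of_mem _ hb) _ (memA₀.1 hp).2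
          _ (memB₀.1 hq').2 hab
        rw [hmemN, hmemN, hπ, QuotientAddGroup.mk_sub, QuotientAddGroup.mk_sub]
        exact h'
      cosetCount_add := by
        have := hq.cosetCount_add
        rw [← image_mk_add_eq K A B, ← cosetCount_comap_mk, ← cosetCount_comap_mk,
          ← cosetCount_comap_mk] at this
        exact this
      bottom := Or.inr (Or.inr (Or.inr hVIII)) }

end TypeEight

end Grynkiewicz2009

end Literature.Combinatorics.Additive
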